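import Literature.NumberTheory.EllipticCurves.Kato2004.IwasawaInvolutionTwistProofs
import Literature.NumberTheory.EllipticCurves.IwasawaSelmerProofs
import Literature.NumberTheory.EllipticCurves.IwasawaSelmerDualUniquenessProofs
import HarnessLib

/-!
# The Iwasawa-involution twist of a dual SELMER datum: `W.SelmerDualData κ γ ↦ W.SelmerDualData κ γ⁻¹` is the
# `ι`-twist `X ↦ X^ι`; lengths, finite generation, torsion and characteristic ideals across the two keys
# (proofs only; 0 def, 0 fact) — the `SelmerDualData` twin of §3 of `IwasawaInvolutionTwistProofs`

Topic `NumberTheory/EllipticCurves`, sub-directory `Kato2004` (namespace = path). THEOREMS ONLY: no definition, no named fact,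
no `instance`, no notation, no `sorry`; nothing about any main conjecture or BSD is asserted.

The tree's dual Selmer data `D : W.SelmerDualData κ γ` (`X = Hom(Sel_{p^∞}(E/K_∞), ℚ/ℤ)`, file `IwasawaSelmer`) let `T` act by
PRE-composition with `conj_γ` (`SelmerDualData.toDual_T_smul`), exactly as the dual fine Selmer data do; §3 of
`IwasawaInvolutionTwistProofs` proved that the datum of key `γ⁻¹` is the `ι`-twist of the datum of key `γ` for the FINE data.
This file repeats it for `SelmerDualData` (cell `bsd-cited` ARM-P ticket T-TWIST-SEL-1, «`exists_twist_selmerDualData_invol`»):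

* `selmerDualData_toDual_invol_one_add_X_smul` — in `D : W.SelmerDualData κ γ`, `ι(1+T)` acts as `x ↦ x ∘ conj_δ` for `γδ = 1`;
* `selmerDualData_exists_involTwist` — for `γδ = 1` and `D` of key `γ` there is `D'` of key `δ` on the SAME character group with the
  `Λ`-structure twisted by `ι` (an `ι`-semilinear `e : D.X ≃+ D'.X` over `toDual`); `conj_mem` for `δ` is the tree theorem
  `map_conjH1_selmerGroupOver_le_holds` (the Selmer group is stable under every conjugation);
* `selmerDualData_lengthAt_inv_eq` / `…_eq_inv` — for ANY `D` of key `γ` and ANY `D'` of key `γ⁻¹`: `ℓ_𝔓(D'.X) = ℓ_{ι𝔓}(D.X)`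
  (uniqueness at each key, `SelmerDualData.nonempty_linearEquiv_holds`);
* `selmerDualData_finite_inv`, `selmerDualData_isTorsion_inv` — finite generation and torsion pass between the keys;
* `selmerDualData_charIdeal_inv_eq` — `char(D'.X) = ι(char(D.X))`; hence `ι(char D.X) = char D.X ↔ ι(char D'.X) = char D'.X`
  (`selmerDualData_map_invol_charIdeal_iff_inv`).

Motivation (cell `bsd-2adic`, seat `addL2x` GEN 16, crux stmt-BirchSwinnertonDyer-19098; pen RC-364 (1) AP4): the PRINT-EXACT
§17.13 packages (`Kato2004.MultDivisibilityInputsContra`, file `DivisibilityInputsContragredient`) are keyed to `γ⁻¹`; these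
lemmas carry every height-one statement between the key-`γ⁻¹` datum and the key-`γ` datum used by the cell's doors and route
statements (the END statements are thereby `ι`-safe in the kernel, not only on paper).

References: R. Greenberg, Adv. Stud. Pure Math. 17 (1989) §0 pp. 101–102 (`S^ι`) [Greenberg1989]; R. Greenberg, LNM 1716 (1999) §1
p. 60 [GreenbergLNM1716]; L. Washington, GTM 83, §13.2 [Washington1997]; tree: `IwasawaSelmer.lean`, `IwasawaSelmerProofs.lean`
(`map_conjH1_selmerGroupOver_le_holds`), `IwasawaSelmerDualUniquenessProofs.lean` (`nonempty_linearEquiv_holds`),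
`Kato2004/IwasawaInvolutionTwistProofs.lean` (§2 transport, §3 fine twin), `IwasawaAlgebraSemilinearCharIdealProofs.lean`.
-/

noncomputable section

open scoped NumberField nonZeroDivisors
open Field
open Literature.NumberTheory.GaloisRepresentations
open Literature.NumberTheory.EllipticCurves Literature.NumberTheory.EllipticCurves.IwasawaAlgebra

universe u

namespace Literature.NumberTheory.EllipticCurves.Kato2004

section SelmerTwist

variable {K : Type u} [Field K] [NumberField K] {W : WeierstrassCurve K} {p : ℕ} [Fact p.Prime]
  {κ : ZpExtension K p} {γ δ : Field.absoluteGaloisGroup K}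

/-- In `D : W.SelmerDualData κ γ` the unit `ι(1 + T)` acts as `x ↦ x ∘ conj_δ` for `γ δ = 1` (`(1 + T)` acts as
`x ↦ x ∘ conj_γ` and `conj` is an action; the Selmer group is stable under `conj_δ` by
`map_conjH1_selmerGroupOver_le_holds`). Twin of `fineSelmerDualData_toDual_invol_one_add_X_smul`.
[cite: GreenbergLNM1716, §1 p. 60] -/
theorem selmerDualData_toDual_invol_one_add_X_smul (hγδ : γ * δ = 1) (D : W.SelmerDualData κ γ)
    (x : D.X) (s : W.selmerInfty κ) :
    D.toDual (invol p (1 + PowerSeries.X) • x) s =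
      D.toDual x ⟨W.conjH1 p κ.kerSubgroup δ s,
        W.map_conjH1_selmerGroupOver_le_holds p κ.kerSubgroup δ ⟨s, s.2, rfl⟩⟩ := by
  set y : D.X := invol p (1 + PowerSeries.X) • x with hy
  have hx : x = (1 + PowerSeries.X : IwasawaAlgebra p) • y := by
    rw [hy, ← mul_smul, one_add_X_mul_invol_one_add_X p, one_smul]
  have h1 : ∀ s' : W.selmerInfty κ, D.toDual ((1 + PowerSeries.X : IwasawaAlgebra p) • y) s' =
      D.toDual y ⟨W.conjH1 p κ.kerSubgroup γ s', D.conj_mem s' s'.2⟩ := by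
    intro s'
    rw [add_smul, one_smul, map_add, AddMonoidHom.add_apply, D.toDual_T_smul, add_sub_cancel]
  conv_rhs => rw [hx, h1]
  congr 1
  apply Subtype.ext
  change (s : W.subgroupH1 p κ.kerSubgroup) =
    W.conjH1 p κ.kerSubgroup γ (W.conjH1 p κ.kerSubgroup δ (s : W.subgroupH1 p κ.kerSubgroup))
  rw [← AddMonoidHom.comp_apply, ← W.conjH1_mul_holds p κ.kerSubgroup γ δ, hγδ,
    W.conjH1_one_holds p κ.kerSubgroup, AddMonoidHom.id_apply]

/-- **The `γ ↦ δ = γ⁻¹` twist of a dual Selmer datum is its `ι`-twist** (ticket T-TWIST-SEL-1): for `γ δ = 1` and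
`D : W.SelmerDualData κ γ` there is `D' : W.SelmerDualData κ δ` on the same character group with the `Λ`-structure twisted by `ι`
(an `ι`-semilinear `e : D.X ≃+ D'.X` over `toDual`). Twin of `fineSelmerDualData_exists_involTwist`; Literature re-derivation,
named-`ι` spelling, of the Summits-side `Summit…Theorems.ChromaticCommonZeros.selmerDualData_exists_involTwist` (another cell's
door file), so that Literature consumers can cite it. [cite: GreenbergLNM1716, §1 p. 60] [cite: Greenberg1989, §0 pp. 101–102] -/
theorem selmerDualData_exists_involTwist (hγδ : γ * δ = 1) (D : W.SelmerDualData κ γ) :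
    ∃ (D' : W.SelmerDualData κ δ) (e : D.X ≃+ D'.X),
      (∀ (f : IwasawaAlgebra p) (x : D.X), e (f • x) = invol p f • e x) ∧
      ∀ x : D.X, D'.toDual (e x) = D.toDual x := by
  refine ⟨@WeierstrassCurve.SelmerDualData.mk K _ _ W p _ κ δ D.X D.addCommGroup
      (Module.compHom D.X (invol p).toRingHom)
      (fun s hs ↦ W.map_conjH1_selmerGroupOver_le_holds p κ.kerSubgroup δ ⟨s, hs, rfl⟩)
      D.toDual D.bijective ?_ ?_,
    AddEquiv.refl D.X, ?_, ?_⟩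
  · intro x s
    change D.toDual (invol p PowerSeries.X • x) s = _
    have hX : invol p (PowerSeries.X : IwasawaAlgebra p) = invol p (1 + PowerSeries.X) - 1 := by
      rw [map_add, map_one, add_sub_cancel_left]
    rw [hX, sub_smul, one_smul, map_sub, AddMonoidHom.sub_apply,
      selmerDualData_toDual_invol_one_add_X_smul hγδ D x s]
  · intro c x s k hk
    change D.toDual (invol p (PowerSeries.C c) • x) s = _
    rw [invol_C]
    exact D.toDual_C_smul c x s k hk
  · intro f x
    change f • x = invol p (invol p f) • x
    rw [invol_invol]
  · intro x
    rfl

/-- **`ℓ_𝔓(D') = ℓ_{ι𝔓}(D)` for ANY dual Selmer data `D` of key `γ` and `D'` of key `γ⁻¹`** (the twisted datum has these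
lengths by `lengthAt_eq_of_involSemilinear`, and any two data of key `γ⁻¹` are `Λ`-isomorphic,
`SelmerDualData.nonempty_linearEquiv_holds`). [cite: GreenbergLNM1716, §1 p. 60] [cite: Greenberg1989, §0 pp. 101–102] -/
theorem selmerDualData_lengthAt_inv_eq (D : W.SelmerDualData κ γ) (D' : W.SelmerDualData κ γ⁻¹)
    (𝔓 : PrimeSpectrum (IwasawaAlgebra p)) :
    Module.lengthAt (IwasawaAlgebra p) D'.X 𝔓 =
      Module.lengthAt (IwasawaAlgebra p) D.X (PrimeSpectrum.comap (invol p).toRingHom 𝔓) := by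
  obtain ⟨D₁, e, he, -⟩ := selmerDualData_exists_involTwist (mul_inv_cancel γ) D
  obtain ⟨e'⟩ := WeierstrassCurve.SelmerDualData.nonempty_linearEquiv_holds D' D₁
  rw [Module.lengthAt_eq_of_linearEquiv e' 𝔓, lengthAt_eq_of_involSemilinear e he 𝔓]

/-- The same with the roles exchanged: `ℓ_𝔓(D) = ℓ_{ι𝔓}(D')` for `D` of key `γ`, `D'` of key `γ⁻¹`.
[cite: GreenbergLNM1716, §1 p. 60] -/
theorem selmerDualData_lengthAt_eq_inv (D : W.SelmerDualData κ γ) (D' : W.SelmerDualData κ γ⁻¹)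
    (𝔓 : PrimeSpectrum (IwasawaAlgebra p)) :
    Module.lengthAt (IwasawaAlgebra p) D.X 𝔓 =
      Module.lengthAt (IwasawaAlgebra p) D'.X (PrimeSpectrum.comap (invol p).toRingHom 𝔓) := by
  rw [selmerDualData_lengthAt_inv_eq D D', comap_invol_comap_invol]

/-- **Finite generation passes from key `γ` to key `γ⁻¹`.** [cite: GreenbergLNM1716, §1 p. 60] -/
theorem selmerDualData_finite_inv (D : W.SelmerDualData κ γ) [Module.Finite (IwasawaAlgebra p) D.X]
    (D' : W.SelmerDualData κ γ⁻¹) : Module.Finite (IwasawaAlgebra p) D'.X := by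
  obtain ⟨D₁, e, he, -⟩ := selmerDualData_exists_involTwist (mul_inv_cancel γ) D
  obtain ⟨e'⟩ := WeierstrassCurve.SelmerDualData.nonempty_linearEquiv_holds D' D₁
  haveI : Module.Finite (IwasawaAlgebra p) D₁.X := finite_of_involSemilinear e he
  exact Module.Finite.equiv e'.symm

/-- **Torsion passes from key `γ` to key `γ⁻¹`.** [cite: GreenbergLNM1716, §1 p. 60] -/
theorem selmerDualData_isTorsion_inv (D : W.SelmerDualData κ γ) (hD : D.IsTorsion)
    (D' : W.SelmerDualData κ γ⁻¹) : D'.IsTorsion := by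
  obtain ⟨D₁, e, he, -⟩ := selmerDualData_exists_involTwist (mul_inv_cancel γ) D
  obtain ⟨e'⟩ := WeierstrassCurve.SelmerDualData.nonempty_linearEquiv_holds D' D₁
  have h₁ : Module.IsTorsion (IwasawaAlgebra p) D₁.X := isTorsion_of_involSemilinear hD e he
  intro x
  obtain ⟨a, ha⟩ := @h₁ (e' x)
  refine ⟨a, ?_⟩
  rw [Submonoid.smul_def] at ha ⊢
  apply e'.injective
  rw [map_smul, map_zero]
  exact ha

/-- **`char(D'.X) = ι(char(D.X))`** for `D` of key `γ`, `D'` of key `γ⁻¹` (transport of the characteristic ideal along the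
`ι`-semilinear equivalence, `Module.charIdeal_eq_map_of_semilinearEquiv`, and along the `Λ`-isomorphism of uniqueness).
[cite: GreenbergLNM1716, §1 p. 60] [cite: Washington1997, §13.2] -/
theorem selmerDualData_charIdeal_inv_eq (D : W.SelmerDualData κ γ) (D' : W.SelmerDualData κ γ⁻¹) :
    Module.charIdeal (IwasawaAlgebra p) D'.X =
      (Module.charIdeal (IwasawaAlgebra p) D.X).map (invol p).toRingHom := by
  obtain ⟨D₁, e, he, -⟩ := selmerDualData_exists_involTwist (mul_inv_cancel γ) D
  obtain ⟨e'⟩ := WeierstrassCurve.SelmerDualData.nonempty_linearEquiv_holds D' D₁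
  have h1 : Module.charIdeal (IwasawaAlgebra p) D'.X = Module.charIdeal (IwasawaAlgebra p) D₁.X := by
    unfold Module.charIdeal
    refine finprod_congr fun 𝔓 => ?_
    rw [Module.lengthAt_eq_of_linearEquiv e' 𝔓]
  have h2 := Module.charIdeal_eq_map_of_semilinearEquiv
    (involEquiv p : IwasawaAlgebra p ≃+* IwasawaAlgebra p) e (fun r m ↦ he r m)
  rw [h1, h2]
  rfl

/-- **`ι(char D.X) = char D.X ↔ ι(char D'.X) = char D'.X`** for `D` of key `γ`, `D'` of key `γ⁻¹`: Greenberg's symmetry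
is insensitive to the key (`ι` is an involution). [cite: GreenbergLNM1716, Thm. 1.14 (p. 68) and §1 p. 60] -/
theorem selmerDualData_map_invol_charIdeal_iff_inv (D : W.SelmerDualData κ γ) (D' : W.SelmerDualData κ γ⁻¹) :
    (Module.charIdeal (IwasawaAlgebra p) D.X).map (invol p).toRingHom = Module.charIdeal (IwasawaAlgebra p) D.X ↔
      (Module.charIdeal (IwasawaAlgebra p) D'.X).map (invol p).toRingHom =
        Module.charIdeal (IwasawaAlgebra p) D'.X := by
  have hinv : ∀ I : Ideal (IwasawaAlgebra p), (I.map (invol p).toRingHom).map (invol p).toRingHom = I := by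
    intro I
    rw [Ideal.map_map]
    have hc : ((invol p).toRingHom.comp (invol p).toRingHom) = RingHom.id _ :=
      RingHom.ext fun f => invol_invol p f
    rw [hc, Ideal.map_id]
  rw [selmerDualData_charIdeal_inv_eq D D']
  constructor
  · intro h
    rw [h, h]
  · intro h
    have h' := congrArg (fun I => Ideal.map (invol p).toRingHom I) h
    simp only [hinv] at h'
    exact h'

end SelmerTwist

end Literature.NumberTheory.EllipticCurves.Kato2004

end
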